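import Summits.HodgeConjecture.HodgeConjecture.Theorems.WeilTypeLadderTargetTransfer
import HarnessLib

/-!
# WeilTypeLadder · target transfer: the R∞- and R2₈-shaped case bodies (every `n`, every `d`; split eightfolds)

b2b cell `hweil` (packet `run/shared/lean/b2b/hodge-weil/`, report `b2b-hweil-pv3-g39/ORDERING-LEMMA.md` §3 and ADDENDUM A).
Companion of `Theorems/WeilTypeLadderTargetTransfer` (principle `mem_algebraicClasses_of_targetTransferFamily`: the target
`X'` is an arbitrary smooth projective variety whose rational `(p,p)`-classes are algebraic — HYPOTHESIS `hXH` —, the only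
named-fact binder is `fulton1998_map_mem_algebraicClasses`; there the R1′-shaped bodies and the `ℤ/18` family).

The packet's PROPOSITION CYC transfers the `K`-Weil classes of the `ζ_m`-primitive Prym of a `ℤ/m`-cover of `ℙ¹`, for an
imaginary quadratic subfield `K ⊊ ℚ(ζ_m)`, to Hodge classes on the PRODUCT `(Xʰₘ)^{[ℚ(ζ_m):K]}` of Fermat varieties
(algebraic by Shioda 1979 Thm. 2 for `m` prime or `m ≤ 20`). In dimension `8` (`(m, N) ∈ {(8,6), (12,6)}`, `E`-rank `4`;
`(15,4), (16,4), (20,4)`, `E`-rank `2` — ADDENDUM A's EIGHTFOLD SCAN) such loci are CASES of the rungs R2₈ (`SplitEightfolds`,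
the split ones) and R∞ (`WeilClassesImaginaryQuadratic`, all of them). This file types the two bodies:

* `weilClassesImaginaryQuadratic_targetTransfer_of_facts` / `_of_weilClassesImaginaryQuadratic` / `_of_hodgeConjecture` — the
  body of R∞ (rung binders VERBATIM FIRST: `2 ≤ n`, `0 < d`, `A`, `φ`, `dim A = 2n`, smooth projective, `φ² = −d`), then the
  target datum `(X', T, k, hX', hXH, hT, a, ι, b)`, then per class with `a^* c ∈ ⨆ᵢ (bᵢ)^*(span of rational (n,n) of X')`:
  rational `(n,n)` in the Weil plane ⇒ algebraic — from the fact; from the rung (datum unused); ON-PATH.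
* `splitEightfolds_targetTransfer_of_facts` / `_of_splitEightfolds` / `_of_hodgeConjecture` — the body of R2₈ (`SplitEightfolds`,
  every `d`, the HYPERBOLICITY binder carried), then the datum, then the per-class conclusion at `n = 4`.

HONEST LABEL: which eightfolds carry the datum (PROPOSITION CYC on the scanned families), that the target's Hodge classes are
algebraic (Shioda Thm. 2, CITED) and which loci are split (the scan, machine-exact) are NOT decided in the kernel; sub-families,
not general members; 0 unconditional rungs; Markman-free. No `sorry`, no new definition, no new named fact.
-/

noncomputable section

-- every declaration of this problem lives in `Summit.HodgeConjecture.HodgeConjecture.…` (summit = sub-problem)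
set_option linter.dupNamespace false

open CategoryTheory
open Literature.AlgebraicGeometry Literature.AlgebraicGeometry.Motives
open Literature.AlgebraicGeometry.HodgeTheory
open Literature.AlgebraicTopology.SingularHomology

namespace Summit.HodgeConjecture.HodgeConjecture.WeilTypeLadder

/-! ### §1 R∞-shaped body (`WeilClassesImaginaryQuadratic`, every `n ≥ 2`, every `d`) with a target datum -/

section Rinfty

/-- **R∞ on the target-dominated locus, from the fact.** The body of `WeilClassesImaginaryQuadratic` (rung binders first and
verbatim), then a datum `(X', T, k, hX', hXH, hT, a, ι, b)` — `X'` smooth projective with algebraic rational `(n,n)`-classes,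
`dim T = 2n`, `a` surjective, `b : ι → (T ⟶ X')` — then for every class of the Weil plane with
`a^* c ∈ ⨆ᵢ (bᵢ)^*(span of the rational (n,n)-classes of X')`: rational of type `(n,n)` ⇒ algebraic.
[cite: Fulton1998, §19.2 Cor. 19.2 (b)] [cite: vanGeemen1994HodgeAV, 4.9–4.12] -/
theorem weilClassesImaginaryQuadratic_targetTransfer_of_facts (hP : fulton1998_map_mem_algebraicClasses) :
    ∀ (n : ℕ), 2 ≤ n → ∀ (d : ℕ), 0 < d → ∀ (A : Motives.AbelianVariety ℂ) (φ : A ⟶ A), A.dim = 2 * n →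
      Motives.IsSmoothProjective (2 * n) A.X → φ ≫ φ = -(d • 𝟙 A) →
    ∀ (X T : Motives.SchemeOver ℂ) (k : ℕ), IsSmoothProjective k X →
      Submodule.span ℂ {x : complexBetti X (2 * n) | IsRationalClass x ∧ IsOfHodgeType k X (2 * n) n n x} ≤
        algebraicClasses X n →
      IsSmoothProjective (2 * n) T →
    ∀ (a : T ⟶ A.X), AlgebraicGeometry.Surjective a.left → ∀ (ι : Type) (b : ι → (T ⟶ X)),
      ∀ c : complexBetti A.X (2 * n),
        complexBetti.map a (2 * n) c ∈ (⨆ i, (Submodule.span ℂ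
            {x : complexBetti X (2 * n) | IsRationalClass x ∧ IsOfHodgeType k X (2 * n) n n x}).map
              (complexBetti.map (b i) (2 * n)).hom) →
        IsRationalClass c → IsOfHodgeType (2 * n) A.X (2 * n) n n c → c ∈ weilClassesOf A φ n d →
          c ∈ algebraicClasses A.X n := by
  intro n _ d _ A φ hA _ _ X T k hX hXH hT a ha ι b c hc _ _ _
  exact abelianVariety_mem_algebraicClasses_of_targetTransferFamily hP A hX hXH (hA ▸ hT) a b hc

/-- **The same body from the rung R∞ itself** (`WeilClassesImaginaryQuadratic`; the datum is not used): the
target-dominated locus is a CASE of the rung. -/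
theorem weilClassesImaginaryQuadratic_targetTransfer_of_weilClassesImaginaryQuadratic
    (h : WeilClassesImaginaryQuadratic) :
    ∀ (n : ℕ), 2 ≤ n → ∀ (d : ℕ), 0 < d → ∀ (A : Motives.AbelianVariety ℂ) (φ : A ⟶ A), A.dim = 2 * n →
      Motives.IsSmoothProjective (2 * n) A.X → φ ≫ φ = -(d • 𝟙 A) →
    ∀ (X T : Motives.SchemeOver ℂ) (k : ℕ), IsSmoothProjective k X →
      Submodule.span ℂ {x : complexBetti X (2 * n) | IsRationalClass x ∧ IsOfHodgeType k X (2 * n) n n x} ≤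
        algebraicClasses X n →
      IsSmoothProjective (2 * n) T →
    ∀ (a : T ⟶ A.X), AlgebraicGeometry.Surjective a.left → ∀ (ι : Type) (b : ι → (T ⟶ X)),
      ∀ c : complexBetti A.X (2 * n),
        complexBetti.map a (2 * n) c ∈ (⨆ i, (Submodule.span ℂ
            {x : complexBetti X (2 * n) | IsRationalClass x ∧ IsOfHodgeType k X (2 * n) n n x}).map
              (complexBetti.map (b i) (2 * n)).hom) →
        IsRationalClass c → IsOfHodgeType (2 * n) A.X (2 * n) n n c → c ∈ weilClassesOf A φ n d →
          c ∈ algebraicClasses A.X n := by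
  intro n hn d hd A φ hA hS hφ _ _ _ _ _ _ _ _ _ _ c _ hr ht hw
  exact h n hn d hd A φ hA hS hφ c hr ht hw

/-- **On-path lemma**: the Hodge conjecture implies R∞ on the target-dominated locus
(`HodgeConjecture → WeilClassesImaginaryQuadratic →` the locus). -/
theorem weilClassesImaginaryQuadratic_targetTransfer_of_hodgeConjecture (h : _root_.HodgeConjecture) :
    ∀ (n : ℕ), 2 ≤ n → ∀ (d : ℕ), 0 < d → ∀ (A : Motives.AbelianVariety ℂ) (φ : A ⟶ A), A.dim = 2 * n →
      Motives.IsSmoothProjective (2 * n) A.X → φ ≫ φ = -(d • 𝟙 A) →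
    ∀ (X T : Motives.SchemeOver ℂ) (k : ℕ), IsSmoothProjective k X →
      Submodule.span ℂ {x : complexBetti X (2 * n) | IsRationalClass x ∧ IsOfHodgeType k X (2 * n) n n x} ≤
        algebraicClasses X n →
      IsSmoothProjective (2 * n) T →
    ∀ (a : T ⟶ A.X), AlgebraicGeometry.Surjective a.left → ∀ (ι : Type) (b : ι → (T ⟶ X)),
      ∀ c : complexBetti A.X (2 * n),
        complexBetti.map a (2 * n) c ∈ (⨆ i, (Submodule.span ℂ
            {x : complexBetti X (2 * n) | IsRationalClass x ∧ IsOfHodgeType k X (2 * n) n n x}).map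
              (complexBetti.map (b i) (2 * n)).hom) →
        IsRationalClass c → IsOfHodgeType (2 * n) A.X (2 * n) n n c → c ∈ weilClassesOf A φ n d →
          c ∈ algebraicClasses A.X n :=
  weilClassesImaginaryQuadratic_targetTransfer_of_weilClassesImaginaryQuadratic
    (weilClassesImaginaryQuadratic_of_hodgeConjecture h)

end Rinfty

/-! ### §2 R2₈-shaped body (`SplitEightfolds`, every `d`) with a target datum -/

section Rtwo

/-- **R2₈ on the target-dominated locus, from the fact.** The body of `SplitEightfolds` (rung binders first and verbatim,
every `d`; the HYPERBOLICITY binder — some `K`-symmetrised hyperplane class is hyperbolic — carried and unused), then a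
datum `(X', T, k, hX', hXH, hT, a, ι, b)`, then for every class of the Weil plane with `a^* c ∈ ⨆ᵢ (bᵢ)^*(span of the
rational (4,4)-classes of X')`: rational of type `(4,4)` ⇒ algebraic. [cite: Fulton1998, §19.2 Cor. 19.2 (b)]
[cite: Markman2025SecantWeil, §1.2 and p. 7 after Thm. 1.5.1] -/
theorem splitEightfolds_targetTransfer_of_facts (hP : fulton1998_map_mem_algebraicClasses) :
    ∀ (d : ℕ), 0 < d → ∀ (A : Motives.AbelianVariety ℂ) (φ : A ⟶ A), A.dim = 2 * 4 →
      Motives.IsSmoothProjective (2 * 4) A.X → φ ≫ φ = -(d • 𝟙 A) →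
      ∀ (e : Motives.ProjectiveEmbedding A.X)
        (a : complexBetti (Motives.projectiveSpace e.n ℂ) 2), IsRationalClass a → a ≠ 0 →
        Motives.IsHyperbolicWeilType A φ 4
          ((d : ℂ) • complexBetti.map e.ι 2 a +
            complexBetti.map φ.hom.hom.hom 2 (complexBetti.map e.ι 2 a)) →
    ∀ (X T : Motives.SchemeOver ℂ) (k : ℕ), IsSmoothProjective k X →
      Submodule.span ℂ {x : complexBetti X (2 * 4) | IsRationalClass x ∧ IsOfHodgeType k X (2 * 4) 4 4 x} ≤
        algebraicClasses X 4 →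
      IsSmoothProjective (2 * 4) T →
    ∀ (a' : T ⟶ A.X), AlgebraicGeometry.Surjective a'.left → ∀ (ι : Type) (b : ι → (T ⟶ X)),
      ∀ c : complexBetti A.X (2 * 4),
        complexBetti.map a' (2 * 4) c ∈ (⨆ i, (Submodule.span ℂ
            {x : complexBetti X (2 * 4) | IsRationalClass x ∧ IsOfHodgeType k X (2 * 4) 4 4 x}).map
              (complexBetti.map (b i) (2 * 4)).hom) →
        IsRationalClass c → IsOfHodgeType (2 * 4) A.X (2 * 4) 4 4 c → c ∈ weilClassesOf A φ 4 d →
          c ∈ algebraicClasses A.X 4 := by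
  intro d _ A φ hA _ _ e a₀ _ _ _ X T k hX hXH hT a' ha ι b c hc _ _ _
  exact abelianVariety_mem_algebraicClasses_of_targetTransferFamily hP A hX hXH (hA ▸ hT) a' b hc

/-- **The same body from the rung R2₈ itself** (`SplitEightfolds`; the datum is not used): the target-dominated split
eightfolds are a CASE of the rung. -/
theorem splitEightfolds_targetTransfer_of_splitEightfolds (h : SplitEightfolds) :
    ∀ (d : ℕ), 0 < d → ∀ (A : Motives.AbelianVariety ℂ) (φ : A ⟶ A), A.dim = 2 * 4 →
      Motives.IsSmoothProjective (2 * 4) A.X → φ ≫ φ = -(d • 𝟙 A) →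
      ∀ (e : Motives.ProjectiveEmbedding A.X)
        (a : complexBetti (Motives.projectiveSpace e.n ℂ) 2), IsRationalClass a → a ≠ 0 →
        Motives.IsHyperbolicWeilType A φ 4
          ((d : ℂ) • complexBetti.map e.ι 2 a +
            complexBetti.map φ.hom.hom.hom 2 (complexBetti.map e.ι 2 a)) →
    ∀ (X T : Motives.SchemeOver ℂ) (k : ℕ), IsSmoothProjective k X →
      Submodule.span ℂ {x : complexBetti X (2 * 4) | IsRationalClass x ∧ IsOfHodgeType k X (2 * 4) 4 4 x} ≤
        algebraicClasses X 4 →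
      IsSmoothProjective (2 * 4) T →
    ∀ (a' : T ⟶ A.X), AlgebraicGeometry.Surjective a'.left → ∀ (ι : Type) (b : ι → (T ⟶ X)),
      ∀ c : complexBetti A.X (2 * 4),
        complexBetti.map a' (2 * 4) c ∈ (⨆ i, (Submodule.span ℂ
            {x : complexBetti X (2 * 4) | IsRationalClass x ∧ IsOfHodgeType k X (2 * 4) 4 4 x}).map
              (complexBetti.map (b i) (2 * 4)).hom) →
        IsRationalClass c → IsOfHodgeType (2 * 4) A.X (2 * 4) 4 4 c → c ∈ weilClassesOf A φ 4 d →
          c ∈ algebraicClasses A.X 4 := by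
  intro d hd A φ hA hS hφ e a₀ hr₀ hne hhyp _ _ _ _ _ _ _ _ _ _ c _ hr ht hw
  exact h d hd A φ hA hS hφ e a₀ hr₀ hne hhyp c hr ht hw

/-- **On-path lemma**: the Hodge conjecture implies R2₈ on the target-dominated locus
(`HodgeConjecture → SplitEightfolds →` the locus). -/
theorem splitEightfolds_targetTransfer_of_hodgeConjecture (h : _root_.HodgeConjecture) :
    ∀ (d : ℕ), 0 < d → ∀ (A : Motives.AbelianVariety ℂ) (φ : A ⟶ A), A.dim = 2 * 4 →
      Motives.IsSmoothProjective (2 * 4) A.X → φ ≫ φ = -(d • 𝟙 A) →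
      ∀ (e : Motives.ProjectiveEmbedding A.X)
        (a : complexBetti (Motives.projectiveSpace e.n ℂ) 2), IsRationalClass a → a ≠ 0 →
        Motives.IsHyperbolicWeilType A φ 4
          ((d : ℂ) • complexBetti.map e.ι 2 a +
            complexBetti.map φ.hom.hom.hom 2 (complexBetti.map e.ι 2 a)) →
    ∀ (X T : Motives.SchemeOver ℂ) (k : ℕ), IsSmoothProjective k X →
      Submodule.span ℂ {x : complexBetti X (2 * 4) | IsRationalClass x ∧ IsOfHodgeType k X (2 * 4) 4 4 x} ≤
        algebraicClasses X 4 →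
      IsSmoothProjective (2 * 4) T →
    ∀ (a' : T ⟶ A.X), AlgebraicGeometry.Surjective a'.left → ∀ (ι : Type) (b : ι → (T ⟶ X)),
      ∀ c : complexBetti A.X (2 * 4),
        complexBetti.map a' (2 * 4) c ∈ (⨆ i, (Submodule.span ℂ
            {x : complexBetti X (2 * 4) | IsRationalClass x ∧ IsOfHodgeType k X (2 * 4) 4 4 x}).map
              (complexBetti.map (b i) (2 * 4)).hom) →
        IsRationalClass c → IsOfHodgeType (2 * 4) A.X (2 * 4) 4 4 c → c ∈ weilClassesOf A φ 4 d →
          c ∈ algebraicClasses A.X 4 :=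
  splitEightfolds_targetTransfer_of_splitEightfolds (splitEightfolds_of_hodgeConjecture h)

end Rtwo

end Summit.HodgeConjecture.HodgeConjecture.WeilTypeLadder

end
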